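import Summits.BirchSwinnertonDyer.BirchSwinnertonDyer.Theorems.AdditiveKolyvaginRoadManinFrameResidueProperRTameTwistFull57
import HarnessLib

/-!
# Route `EdixhovenFibreFiveSeven`, crux K★ `StarredOptimalManinUnitFiveSeven` (stmt-BirchSwinnertonDyer-22226),
# line `kato-lever`: registered stub LEVER″ `stub_tameTwistLever57` — Manin's `p`-part at a lattice-optimal
# datum from the tame-twist lever at every additive `p ≥ 5`, off the Kosters–Pannekoek exception, GRANTED F″

Cell `pub/bsd-wall`, seat `bsd-line-edix-p1` g0. ONE registered stub of the line skeleton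
`Cruxes/StarredOptimalManinUnitFiveSeven/Lines/kato_lever.lean` (commit ce60bc104811) proved VERBATIM, by gluing
two tree theorems of seats bsd-wall-manin-p1 g3/g4 (crux `ManinFrameResidueProperR`, line `tame_twist`):
`ManinFrameResidueProperRTameTwist.not_dvd_c_of_tameTwist57` (p579959, `p ∈ {5, 7}`, hypothesis `W(ℚ_p)[p] = 0`)
and `ManinFrameResidueProperRTameTwist.not_dvd_c_of_tameTwistL` (p573163, `p > 7`), the latter fed with the
`p > 7` specialisation of the `p ≥ 5` fact (`kato_neron_of_five_le`: F″ ⟹ F′, the two statement-only Literature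
facts of `Literature/NumberTheory/EllipticCurves/KatoAdditiveTwistedValueNeronIntegrality.lean` differ exactly by
the binder `7 < p` versus `5 ≤ p ∧ (7 < p ∨ …)`). THEOREMS ONLY; conditional on the cite-only fact F″ (binder
`hK`, part of the registered signature); nothing is closed by this file; BSD is not proved by any of this.
-/

set_option autoImplicit false
-- the Cruxes namespace of this sub repeats the summit name by design (D-0017 nested layout)
set_option linter.dupNamespace false

noncomputable section

open scoped Classical MatrixGroups

open WeierstrassCurve NumberField Literature.NumberTheory.EllipticCurves
  Literature.NumberTheory.EllipticCurves.ModularForms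
  Literature.NumberTheory.EllipticCurves.Rank1Residual
  Summit.BirchSwinnertonDyer.BirchSwinnertonDyer.Theorems

namespace Summit.BirchSwinnertonDyer.BirchSwinnertonDyer.Cruxes.StarredOptimalManinUnitFiveSeven.KatoLever

/-- **F″ ⟹ F′**: the `p ≥ 5` Kato–Kim–Nakamura–Kosters–Pannekoek reading
(`kato_neron_isIntegral_twistedSymbolSum_of_additive_five_le`, extra clause `7 < p ∨ (…)`) specialises to the
`p > 7` reading (`kato_neron_isIntegral_twistedSymbolSum_of_additive`) by taking the left disjunct. Pure logic on
two statement-only facts. [cite: Kato2004Asterisque, (8.1.3) (p. 180), Thm. 9.7 (p. 189)]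
[cite: KimNakamura2020, Thm. 2.1, Cor. 2.4] -/
theorem kato_neron_of_five_le (hK : kato_neron_isIntegral_twistedSymbolSum_of_additive_five_le) :
    kato_neron_isIntegral_twistedSymbolSum_of_additive := by
  intro V _ _ N _ f hf p _ h7 hg hm hi m _ hc χ hχp hχ1 hord ϖ r
  exact hK V f hf p (by omega) hg hm hi m hc (Or.inl h7) χ hχp hχ1 hord ϖ r

/-- **Stub LEVER″ of line `kato-lever` (registered signature, verbatim).** GRANTED F″: for `W/ℚ` globally
minimal, additive at a prime `p ≥ 5` with `E[p]` irreducible and (`p > 7` or `W(ℚ_p)` has no point of order `p`),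
`D` a lattice-optimal parametrisation datum (`Λ_W = c·Λ_f`) at a level `N` with `p² ∣ N` and `a_ℓ(W) = ±1` at
every `ℓ ∥ N`: `p ∤ c(D)`. Proof: `p ∈ {5, 7}` ⟹ `not_dvd_c_of_tameTwist57` (the disjunction `hPT` can only hold
through its right branch); `p > 7` ⟹ `not_dvd_c_of_tameTwistL` with F′ := `kato_neron_of_five_le hK`; a prime
`p` with `5 ≤ p ≤ 7` is `5` or `7`. [cite: Kato2004Asterisque, (8.1.3) (p. 180), Thm. 9.7 (p. 189)]
[cite: KimNakamura2020, Cor. 2.4] [cite: KostersPannekoek2017, Thm. 1] [cite: Manin1972, Thm. 1.6] -/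
theorem stub_tameTwistLever57
    (hK : Literature.NumberTheory.EllipticCurves.kato_neron_isIntegral_twistedSymbolSum_of_additive_five_le)
    (p : ℕ) [Fact p.Prime] (W : WeierstrassCurve ℚ) [W.IsElliptic] [W.IsGloballyMinimal] {N : ℕ} [NeZero N]
    (D : ModularParametrizationData W N)
    (hopt : ∀ z ∈ D.L.lattice, ∃ w ∈ periodLattice D.f, z = D.c * w) (hp5 : 5 ≤ p)
    (hPT : 7 < p ∨ ∀ P : (W.baseChange ℚ_[p]).toAffine.Point, p • P = 0 → P = 0)
    (hadd : Addv W p) (hirr : Irr W p) (hpN : p ^ 2 ∣ N)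
    (ha : ∀ ℓ ∈ N.primeFactors, ¬ ℓ ^ 2 ∣ N → W.LFunction ℓ = 1 ∨ W.LFunction ℓ = -1) :
    ¬ (p : ℤ) ∣ D.c := by
  rcases lt_or_ge 7 p with h7 | h7
  · exact ManinFrameResidueProperRTameTwist.not_dvd_c_of_tameTwistL (kato_neron_of_five_le hK) W D hopt h7
      hadd hirr hpN ha
  · have hp57 : p = 5 ∨ p = 7 := by
      have hpP : p.Prime := Fact.out
      interval_cases p
      · exact Or.inl rfl
      · exact absurd hpP (by decide)
      · exact Or.inr rfl
    have hPT' : ∀ P : (W.baseChange ℚ_[p]).toAffine.Point, p • P = 0 → P = 0 := by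
      rcases hPT with h | h
      · omega
      · exact h
    exact ManinFrameResidueProperRTameTwist.not_dvd_c_of_tameTwist57 hK hp57 W D hopt hPT' hadd hirr hpN ha

end Summit.BirchSwinnertonDyer.BirchSwinnertonDyer.Cruxes.StarredOptimalManinUnitFiveSeven.KatoLever

end
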